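import Literature.AlgebraicGeometry.Limits.LocalizationSmoothProperSpread
import Literature.AlgebraicGeometry.Limits.RelativeDimensionDescent
import HarnessLib

/-!
# Limits of schemes: the relative dimension of the generic fibre spreads out with smoothness
# (EGA IV₄ 17.7.8; Görtz–Wedhorn I 6.15; Hartshorne III 10.1 (b); Stacks 0C0C, 081F, 01UA)

Topic `Literature/AlgebraicGeometry/Limits`. Theorems only (no definition, no named fact, no instance);
sequel of `Limits/LocalizationSmoothProperSpread` (one stage below which a prescribed `A`-scheme with
smooth proper generic fibre is smooth, proper and flat) and `Limits/RelativeDimensionDescent` (the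
relative dimension of a smooth morphism is read off after a base change with DENSE image).

* `LocApprox.smoothOfRelativeDimension_of_genericFibre` — **over an integral affine base, a smooth
  morphism whose generic fibre is smooth of relative dimension `n` is smooth of relative dimension
  `n`**: `T` a domain with fraction field `K`, `Q → Spec T` smooth with
  `Q ×_T Spec K → Spec K` smooth of relative dimension `n` ⇒ `Q → Spec T` smooth of relative
  dimension `n`. The generic fibre `Q ×_T Spec K → Q` has dense image: `Q → Spec T` is flat and
  locally of finite presentation, hence OPEN (EGA IV₂ 2.4.6; Mathlib `UniversallyOpen.of_flat`), so
  every non-empty open subset of `Q` has open non-empty image in `Spec T`, which contains the generic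
  point, i.e. the open set meets the generic fibre; then
  `smoothOfRelativeDimension_of_isPullback_of_denseRange` (relative dimension is locally constant on
  the source — Görtz–Wedhorn I Prop. 6.15 — and stable under base change — Hartshorne III
  Prop. 10.1 (b)).
* `LocApprox.exists_forall_smoothOfRelativeDimension_isProper_flat_snd_of_isUnit` — **a generic fibre
  which is proper and smooth of relative dimension `n` spreads to a proper flat family smooth of
  relative dimension `n`, below ONE stage, unit form**: `A` a Noetherian domain, `K = Frac A`,
  `P → Spec A` quasi-compact, quasi-separated, locally of finite presentation, with
  `P ×_A Spec K → Spec K` proper and smooth of relative dimension `n`; then for some `s ≠ 0` and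
  every commutative `A`-algebra `T` in which `s` is a unit, `P ×_A Spec T → Spec T` is proper, flat
  and smooth of relative dimension `n` (the stage `A[1/s]` is a domain with fraction field `K`, and
  its generic fibre is that of `P`; then base change from the stage to `T`).
* `…_atPrime` (the local rings `A_𝔭`, `s ∉ 𝔭`), `…_of_iso` (generic fibre IDENTIFIED with a
  given proper `K`-scheme `E` smooth of relative dimension `n`, `e₀ : P ×_A Spec K ≅ E` — e.g. a
  smooth projective, not necessarily geometrically connected, CURVE over a number field spreads to a
  smooth proper family of curves over `𝒪[1/s]`) and `…_of_isSmoothProjective`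
  (`Motives.IsSmoothProjective n E`, the geometrically irreducible case).

The total space `P` is NOT assumed irreducible (compare `Limits/SmoothProjectiveModelPrescribedBase`,
which needs an irreducible model to name one relative dimension); flatness of the stage replaces
irreducibility. Not here: geometric irreducibility of the fibres (Stacks 0AY8, treated for an
irreducible model in `Limits/SmoothProjectiveModelPrescribedBase`).

## References

* [EGAIV4] A. Grothendieck, J. Dieudonné, EGA IV₄ (Publ. Math. IHÉS 32, 1967), Prop. 17.7.8.
* [GortzWedhorn2020] U. Görtz, T. Wedhorn, *Algebraic Geometry I: Schemes*, 2nd ed. (2020),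
  Def. 6.14, Prop. 6.15 (smooth of relative dimension `d`: an open condition on the source).
* [EGAIV2] EGA IV₂ (Publ. Math. IHÉS 24, 1965), Thm. 2.4.6 (flat + locally of finite presentation ⇒
  universally open).
* [Hartshorne1977] R. Hartshorne, *Algebraic Geometry* (1977), Ch. III Prop. 10.1 (b).
* [StacksProject] The Stacks Project, Tags 0C0C, 081F (spreading out smoothness / properness to a
  stage), 01UA (flat + lfp ⇒ universally open).
-/

noncomputable section

universe u

open CategoryTheory CategoryTheory.Limits AlgebraicGeometry

namespace Literature.AlgebraicGeometry.Limits

open Literature.AlgebraicGeometry.Motives (SchemeOver specOver IsProjectiveOver IsSmoothProjective)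

set_option backward.isDefEq.respectTransparency false

namespace LocApprox

/-! ## Base change from the stage `Spec A[1/s]` to any `T` in which `s` is a unit (plumbing) -/

section Unit

variable {A : Type u} [CommRing A]

/-- If `i : T → Y` factors as `i = e ≫ j` then `pullback.snd f i` is a base change of
`pullback.snd f j` (along `e`); so a morphism property stable under base change passes from
`X ×_Y Y' → Y'` to `X ×_Y T → T`. [folklore] -/
private theorem of_snd_of_comp_eq' (W : MorphismProperty Scheme.{u}) [W.IsStableUnderBaseChange]
    {X Y Y' T : Scheme.{u}} (f : X ⟶ Y) (j : Y' ⟶ Y) (hW : W (pullback.snd f j)) {i : T ⟶ Y}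
    (e : T ⟶ Y') (he : e ≫ j = i) : W (pullback.snd f i) := by
  subst he
  have h := W.pullback_snd (pullback.snd f j) e hW
  rw [← pullbackLeftPullbackSndIso_inv_snd_snd f j e]
  exact (W.cancel_left_of_respectsIso (pullbackLeftPullbackSndIso f j e).inv _).mpr h

/-- A property stable under base change passes from the stage `P ×_A Spec L → Spec L`, `L` a model
of `A[1/s]`, to `P ×_A Spec T → Spec T` for every commutative `A`-algebra `T` in which `s` is a
unit (`Spec T → Spec A` factors through `Spec L`, `IsLocalization.Away.lift`). [folklore] -/
private theorem of_stage_of_isUnit' (W : MorphismProperty Scheme.{u}) [W.IsStableUnderBaseChange]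
    (P : SchemeOver A) (s : A) (L : Type u) [CommRing L] [Algebra A L] [IsLocalization.Away s L]
    (hW : W (pullback.snd P.hom (Spec.map (CommRingCat.ofHom (algebraMap A L)))))
    (T : Type u) [CommRing T] [Algebra A T] (hs : IsUnit (algebraMap A T s)) :
    W (pullback.snd P.hom (Spec.map (CommRingCat.ofHom (algebraMap A T)))) :=
  of_snd_of_comp_eq' W P.hom _ hW (Spec.map (CommRingCat.ofHom (IsLocalization.Away.lift s hs)))
    (by rw [← Spec.map_comp, ← CommRingCat.ofHom_comp, IsLocalization.Away.lift_comp])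

end Unit

/-! ## The relative dimension of a smooth morphism over an integral base is that of its generic fibre -/

section Generic

variable {T K : Type u} [CommRing T] [IsDomain T] [Field K] [Algebra T K] [IsFractionRing T K]

/-- **The generic fibre of a flat morphism locally of finite presentation over an integral affine
base is dense** (as a subset of the total space): for `T` a domain with fraction field `K` and
`Q → Spec T` flat and locally of finite presentation, the projection `Q ×_T Spec K → Q` has dense
image. Indeed `Q → Spec T` is open (EGA IV₂ 2.4.6), so a non-empty open subset of `Q` has non-empty
open image in `Spec T`, which contains the generic point; a point of `Q` over the generic point
lifts to `Q ×_T Spec K` (Mathlib `Scheme.Pullback.range_fst`). [cite: EGAIV2, Thm. 2.4.6] -/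
theorem denseRange_fst_genericFibre (Q : SchemeOver T) [Flat Q.hom]
    [LocallyOfFinitePresentation Q.hom] :
    DenseRange (pullback.fst Q.hom (Spec.map (CommRingCat.ofHom (algebraMap T K)))).base := by
  rw [DenseRange, dense_iff_inter_open]
  rintro U hU ⟨u, hu⟩
  -- the image of `U` is open and non-empty, hence contains the generic point
  have hopen : IsOpenMap Q.hom.base := Q.hom.isOpenMap
  have hbot : (⊥ : PrimeSpectrum T) ∈ Q.hom.base '' U :=
    bot_mem_of_isOpen_of_mem (hopen U hU) (Set.mem_image_of_mem _ hu)
  obtain ⟨u', hu'U, hu'⟩ := hbot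
  -- the generic point is the image of the point of `Spec K`
  obtain ⟨η, hη⟩ := exists_specOver_hom_apply_eq_bot (nonZeroDivisors T) K le_rfl
  have hmem : u' ∈ Set.range (pullback.fst Q.hom (Spec.map (CommRingCat.ofHom (algebraMap T K)))).base := by
    rw [Scheme.Pullback.range_fst]
    exact ⟨η, hη.trans hu'.symm⟩
  obtain ⟨z, hz⟩ := hmem
  exact ⟨u', ⟨hu'U, z, hz⟩⟩

/-- **Over an integral affine base, the relative dimension of a smooth morphism is that of its
generic fibre** (Görtz–Wedhorn I Prop. 6.15: the locus where a morphism is smooth of relative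
dimension `d` is open in the source; Hartshorne III Prop. 10.1 (b): relative dimension is preserved by
base extension). Let `T` be a domain
with fraction field `K` and `Q → Spec T` smooth, with generic fibre `Q ×_T Spec K → Spec K` smooth of
relative dimension `n`. Then `Q → Spec T` is smooth of relative dimension `n`: the generic fibre is
dense in `Q` (`denseRange_fst_genericFibre`, smooth ⇒ flat + locally of finite presentation), and
`smoothOfRelativeDimension_of_isPullback_of_denseRange`.
[cite: Hartshorne1977, Ch. III Prop. 10.1 (b)] [cite: GortzWedhorn2020, Prop. 6.15] -/
theorem smoothOfRelativeDimension_of_genericFibre (n : ℕ) (Q : SchemeOver T) [Smooth Q.hom]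
    (hn : SmoothOfRelativeDimension n
      (pullback.snd Q.hom (Spec.map (CommRingCat.ofHom (algebraMap T K))))) :
    SmoothOfRelativeDimension n Q.hom := by
  haveI := hn
  exact smoothOfRelativeDimension_of_isPullback_of_denseRange
    (IsPullback.of_hasPullback Q.hom (Spec.map (CommRingCat.ofHom (algebraMap T K)))) n
    (denseRange_fst_genericFibre (K := K) Q)

end Generic

/-! ## Smooth of relative dimension `n`, proper and flat below one stage -/

section Stage

variable {A : Type u} [CommRing A] [IsDomain A] [IsNoetherianRing A]
  (K : Type u) [Field K] [Algebra A K] [IsFractionRing A K]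

/-- **A generic fibre which is proper and smooth of relative dimension `n` spreads to a proper flat
family smooth of relative dimension `n` — unit form** (EGA IV₃ 8.10.5 (xii), IV₄ 17.7.8 (ii);
Stacks 081F, 0C0C; Hartshorne III 10.1 (b)). Let `A` be a Noetherian domain with fraction field `K` and `P → Spec A`
quasi-compact, quasi-separated and locally of finite presentation, with `P ×_A Spec K → Spec K`
proper and smooth of relative dimension `n`. Then there is `s ≠ 0` such that for every commutative
`A`-algebra `T` in which `s` is a unit, `P ×_A Spec T → Spec T` is smooth of relative dimension `n`,
proper and flat. Proof: `exists_forall_smooth_isProper_flat_snd_of_isUnit` gives `s`; the stage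
`L = A[1/s]` is a domain with fraction field `K` whose generic fibre is that of `P`, so
`smoothOfRelativeDimension_of_genericFibre` gives relative dimension `n` over `L`; base change to `T`.
[cite: StacksProject, Tags 081F, 0C0C] [cite: EGAIV4, Prop. 17.7.8] -/
theorem exists_forall_smoothOfRelativeDimension_isProper_flat_snd_of_isUnit {n : ℕ}
    (P : SchemeOver A) [QuasiCompact P.hom] [QuasiSeparated P.hom]
    [LocallyOfFinitePresentation P.hom]
    (hn : SmoothOfRelativeDimension n
      (pullback.snd P.hom (Spec.map (CommRingCat.ofHom (algebraMap A K)))))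
    (hpr : IsProper (pullback.snd P.hom (Spec.map (CommRingCat.ofHom (algebraMap A K))))) :
    ∃ s ∈ nonZeroDivisors A, ∀ (T : Type u) [CommRing T] [Algebra A T],
      IsUnit (algebraMap A T s) →
        SmoothOfRelativeDimension n
            (pullback.snd P.hom (Spec.map (CommRingCat.ofHom (algebraMap A T)))) ∧
          IsProper (pullback.snd P.hom (Spec.map (CommRingCat.ofHom (algebraMap A T)))) ∧
          Flat (pullback.snd P.hom (Spec.map (CommRingCat.ofHom (algebraMap A T)))) := by
  classical
  haveI := hn
  have hsm : Smooth (pullback.snd P.hom (Spec.map (CommRingCat.ofHom (algebraMap A K)))) :=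
    SmoothOfRelativeDimension.smooth n _
  obtain ⟨s, hsS, H⟩ := exists_forall_smooth_isProper_flat_snd_of_isUnit K P hsm hpr
  refine ⟨s, hsS, fun T _ _ hT => ?_⟩
  -- the stage `L = A[1/s]`: a domain with fraction field `K`
  have hs0 : s ≠ 0 := nonZeroDivisors.ne_zero hsS
  let L : Type u := Localization.Away s
  haveI : IsDomain L := IsLocalization.isDomain_of_le_nonZeroDivisors (M := Submonoid.powers s) L
    (powers_le_nonZeroDivisors_of_noZeroDivisors hs0)
  have hunit : IsUnit (algebraMap A K s) :=
    Ne.isUnit ((IsFractionRing.to_map_eq_zero_iff (K := K)).not.mpr hs0)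
  let φ : L →+* K := IsLocalization.Away.lift s hunit
  letI : Algebra L K := φ.toAlgebra
  haveI : IsScalarTower A L K :=
    IsScalarTower.of_algebraMap_eq fun r ↦ (IsLocalization.Away.lift_eq s hunit r).symm
  haveI : IsFractionRing L K :=
    IsFractionRing.isFractionRing_of_isDomain_of_isLocalization (Submonoid.powers s) L _
  set jL : Spec (.of L) ⟶ Spec (.of A) := Spec.map (CommRingCat.ofHom (algebraMap A L)) with hjL
  set jLK : Spec (.of K) ⟶ Spec (.of L) := Spec.map (CommRingCat.ofHom (algebraMap L K)) with hjLK
  have hfac : Spec.map (CommRingCat.ofHom (algebraMap A K)) = jLK ≫ jL := by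
    rw [hjL, hjLK, ← Spec.map_comp, ← CommRingCat.ofHom_comp, ← IsScalarTower.algebraMap_eq]
  -- smooth / proper / flat at the stage
  obtain ⟨hLsm, -, -⟩ := H L (IsLocalization.Away.algebraMap_isUnit s)
  -- the generic fibre of the stage is the generic fibre of `P`
  have hnL : SmoothOfRelativeDimension n (pullback.snd (pullback.snd P.hom jL) jLK) := by
    have h' : SmoothOfRelativeDimension n (pullback.snd P.hom (jLK ≫ jL)) := by rw [← hfac]; exact hn
    rw [← pullbackLeftPullbackSndIso_hom_snd P.hom jL jLK]
    exact (MorphismProperty.cancel_left_of_respectsIso (@SmoothOfRelativeDimension n) _ _).mpr h'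
  haveI : Smooth (Over.mk (pullback.snd P.hom jL) : SchemeOver L).hom := hLsm
  have hL : SmoothOfRelativeDimension n (pullback.snd P.hom jL) :=
    smoothOfRelativeDimension_of_genericFibre (K := K) n (Over.mk (pullback.snd P.hom jL)) hnL
  -- base change to `T`
  obtain ⟨-, hTpr, hTfl⟩ := H T hT
  haveI := smoothOfRelativeDimension_isStableUnderBaseChange (n := n)
  exact ⟨of_stage_of_isUnit' (@SmoothOfRelativeDimension n) P s L hL T hT, hTpr, hTfl⟩

/-- **… at the local rings of the base**: with `s` as above, for every prime `𝔭 ∌ s` of `A` and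
every model `T` of `A_𝔭`, `P ×_A Spec T → Spec T` is smooth of relative dimension `n`, proper and
flat. [cite: StacksProject, Tags 081F, 0C0C] [cite: EGAIV4, Prop. 17.7.8] -/
theorem exists_forall_smoothOfRelativeDimension_isProper_flat_snd_atPrime {n : ℕ}
    (P : SchemeOver A) [QuasiCompact P.hom] [QuasiSeparated P.hom]
    [LocallyOfFinitePresentation P.hom]
    (hn : SmoothOfRelativeDimension n
      (pullback.snd P.hom (Spec.map (CommRingCat.ofHom (algebraMap A K)))))
    (hpr : IsProper (pullback.snd P.hom (Spec.map (CommRingCat.ofHom (algebraMap A K))))) :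
    ∃ s ∈ nonZeroDivisors A, ∀ (p : Ideal A) [p.IsPrime], s ∉ p →
      ∀ (T : Type u) [CommRing T] [Algebra A T] [IsLocalization.AtPrime T p],
        SmoothOfRelativeDimension n
            (pullback.snd P.hom (Spec.map (CommRingCat.ofHom (algebraMap A T)))) ∧
          IsProper (pullback.snd P.hom (Spec.map (CommRingCat.ofHom (algebraMap A T)))) ∧
          Flat (pullback.snd P.hom (Spec.map (CommRingCat.ofHom (algebraMap A T)))) := by
  obtain ⟨s, hsS, H⟩ := exists_forall_smoothOfRelativeDimension_isProper_flat_snd_of_isUnit K P hn hpr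
  exact ⟨s, hsS, fun p _ hsp T _ _ _ =>
    H T (IsLocalization.map_units T ⟨s, show s ∈ p.primeCompl from hsp⟩)⟩

/-- **A generic fibre IDENTIFIED with a given proper `K`-scheme smooth of relative dimension `n`
spreads to a proper flat family smooth of relative dimension `n` — unit form** (the shape in which
an integral model `P` over `A` of a GIVEN smooth proper `K`-scheme `E` — e.g. a smooth projective,
not necessarily geometrically connected, curve: `SmoothOfRelativeDimension 1 E.hom` and
`Motives.IsProjectiveOver E`, whence `IsProper E.hom` by `Motives.IsProjectiveOver.isProper` — is
consumed): `e₀ : P ×_A Spec K ≅ E` an isomorphism of `K`-schemes, `E → Spec K` proper and smooth of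
relative dimension `n`, `P → Spec A` quasi-compact, quasi-separated and locally of finite
presentation over the Noetherian domain `A` ⇒ for some `s ≠ 0` and every commutative `A`-algebra
`T` in which `s` is a unit, `P ×_A Spec T → Spec T` is smooth of relative dimension `n`, proper and
flat (both properties of `E → Spec K` are transported along `e₀`, then `…_of_isUnit`).
[cite: StacksProject, Tags 081F, 0C0C] [cite: EGAIV4, Prop. 17.7.8] -/
theorem exists_forall_smoothOfRelativeDimension_isProper_flat_snd_of_iso {n : ℕ}
    (P : SchemeOver A) [QuasiCompact P.hom] [QuasiSeparated P.hom]
    [LocallyOfFinitePresentation P.hom] {E : SchemeOver K}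
    (hEn : SmoothOfRelativeDimension n E.hom) (hEpr : IsProper E.hom)
    (e₀ : (Over.pullback (specOver A K).hom).obj P ≅ E) :
    ∃ s ∈ nonZeroDivisors A, ∀ (T : Type u) [CommRing T] [Algebra A T],
      IsUnit (algebraMap A T s) →
        SmoothOfRelativeDimension n
            (pullback.snd P.hom (Spec.map (CommRingCat.ofHom (algebraMap A T)))) ∧
          IsProper (pullback.snd P.hom (Spec.map (CommRingCat.ofHom (algebraMap A T)))) ∧
          Flat (pullback.snd P.hom (Spec.map (CommRingCat.ofHom (algebraMap A T)))) := by
  have hw : e₀.hom.left ≫ E.hom =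
      pullback.snd P.hom (Spec.map (CommRingCat.ofHom (algebraMap A K))) := Over.w e₀.hom
  have hn : SmoothOfRelativeDimension n
      (pullback.snd P.hom (Spec.map (CommRingCat.ofHom (algebraMap A K)))) := by
    rw [← hw]
    exact (MorphismProperty.cancel_left_of_respectsIso (@SmoothOfRelativeDimension n) _ _).mpr hEn
  have hpr : IsProper (pullback.snd P.hom (Spec.map (CommRingCat.ofHom (algebraMap A K)))) := by
    rw [← hw]; exact (MorphismProperty.cancel_left_of_respectsIso @IsProper _ _).mpr hEpr
  exact exists_forall_smoothOfRelativeDimension_isProper_flat_snd_of_isUnit K P hn hpr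

/-- **A generic fibre identified with a smooth projective variety of dimension `n` spreads to a
proper flat family smooth of relative dimension `n` — unit form.** Let `E` be a smooth projective
(geometrically irreducible) variety of dimension `n` over `K = Frac A` (`Motives.IsSmoothProjective n E`;
e.g. `n = 1`: a smooth projective geometrically irreducible curve), `P → Spec A` quasi-compact,
quasi-separated and locally of finite presentation over the Noetherian domain `A`, and
`e₀ : P ×_A Spec K ≅ E` an isomorphism of `K`-schemes. Then for some `s ≠ 0` and every commutative
`A`-algebra `T` in which `s` is a unit, `P ×_A Spec T → Spec T` is smooth of relative dimension `n`,
proper and flat (`…_of_iso` with `Motives.IsProjectiveOver.isProper`).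
[cite: StacksProject, Tags 081F, 0C0C] [cite: EGAIV4, Prop. 17.7.8] -/
theorem exists_forall_smoothOfRelativeDimension_isProper_flat_snd_of_isSmoothProjective {n : ℕ}
    (P : SchemeOver A) [QuasiCompact P.hom] [QuasiSeparated P.hom]
    [LocallyOfFinitePresentation P.hom] {E : SchemeOver K} (hE : IsSmoothProjective n E)
    (e₀ : (Over.pullback (specOver A K).hom).obj P ≅ E) :
    ∃ s ∈ nonZeroDivisors A, ∀ (T : Type u) [CommRing T] [Algebra A T],
      IsUnit (algebraMap A T s) →
        SmoothOfRelativeDimension n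
            (pullback.snd P.hom (Spec.map (CommRingCat.ofHom (algebraMap A T)))) ∧
          IsProper (pullback.snd P.hom (Spec.map (CommRingCat.ofHom (algebraMap A T)))) ∧
          Flat (pullback.snd P.hom (Spec.map (CommRingCat.ofHom (algebraMap A T)))) :=
  exists_forall_smoothOfRelativeDimension_isProper_flat_snd_of_iso K P hE.smoothOfRelativeDimension
    hE.isProjectiveOver.isProper e₀

end Stage

end LocApprox

end Literature.AlgebraicGeometry.Limits

end
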